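import Summits.Ventures.PercRepro0.MeanField

/-!
# At criticality: Lemma SAT and CRIT-LOWER (seat p4, block P5 in Lean, supplement)

Two statements of the cell AT `p = p_c(d)`, kernel-checked on `Defs` (census context for block M; nothing here bears on
`θ_d(p_c)` itself):

* **Lemma SAT** (proofs/TMID-census-p6-v2.md §5; here `one_le_phi_pc`): `φ_{p_c(d)}(S) ≥ 1` for every finite `S ∋ 0`
  (`d ≥ 1`) — `φ_q(S) ≥ 1` for `q > p_c` (Lemma 2.3(b), `MeanField.one_le_phi_of_pc_lt`) and `q ↦ φ_q(S)` is continuous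
  (`continuous_phi_clamp`); at `p_c = 1` it is `one_le_phi_one`;
* **CRIT-LOWER** (proofs/CRITLOWER-p4-v1.md, declared D4; here `crit_lower`): for every `d ≥ 1` and `n`,
  `P_{p_c(d)}(0 ↔ ∂Λ_n) ≥ 1 / (2 d² (2n+1)^{d−1})` — only `x ∈ ∂Λ_n` have neighbours outside `Λ_n`
  (`mem_boundary_of_adj_notMem_box`), at most `d` of them for `n ≥ 1` (`card_outNbrs_box_le`), `{0 ↔_{Λ_n} x} ⊆ {0 ↔ ∂Λ_n}`
  for `x ∈ ∂Λ_n` (`P_connIn_box_le`), and `|∂Λ_n| ≤ 2d (2n+1)^{d−1}` (`card_bdryF_le`); the case `n = 0` is `θ_0 = 1`.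
  (Erratum to CRITLOWER-p4-v1 step (i): for `n = 0` the point `0` has `2d` outside neighbours, not `≤ d`; the theorem's
  bound holds there trivially.)

Optional evidence, off every declaration path; nothing claimed on `T(d)` for any `d`.
-/

namespace Summit.Ventures.PercRepro0.Sharp

open MeasureTheory ProbabilityTheory unitInterval Set Filter
open Summit.Ventures.PercRepro0.Defs
open scoped ENNReal Classical Topology

variable {d : ℕ}

/-! ### Lemma SAT -/

/-- `r ↦ φ_{clamp r}(S)` is continuous. -/
theorem continuous_phi_clamp (S : Finset (Vertex d)) : Continuous fun r : ℝ => phi S (clamp r) := by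
  unfold phi
  refine Continuous.mul ?_ (continuous_finsetSum _ fun x _ => Continuous.mul continuous_const ?_)
  · exact continuous_subtype_val.comp (continuous_projIcc (a := (0 : ℝ)) (b := 1) (h := zero_le_one))
  · exact continuous_setBernoulli_clamp_of_determinedBy (bonds d) (bondsIn_finite S.finite_toSet)
      (measurableSet_connIn S.finite_toSet 0 x) (determinedBy_connIn _ 0 x)

/-- **Lemma SAT**: `φ_{p_c(d)}(S) ≥ 1` for every finite `S ∋ 0` (`d ≥ 1`). -/
theorem one_le_phi_pc (hd : 1 ≤ d) {S : Finset (Vertex d)} (hS0 : (0 : Vertex d) ∈ S) :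
    1 ≤ phi S (clamp (pc d)) := by
  rcases eq_or_lt_of_le (pc_le_one hd) with h1 | h1
  · rw [h1, clamp_one]
    exact one_le_phi_one hd hS0
  · have ht : Tendsto (fun r : ℝ => phi S (clamp r)) (𝓝[>] pc d) (𝓝 (phi S (clamp (pc d)))) :=
      (continuous_phi_clamp S).continuousAt.tendsto.mono_left nhdsWithin_le_nhds
    refine ge_of_tendsto ht ?_
    filter_upwards [Ioo_mem_nhdsGT h1] with r hr
    refine one_le_phi_of_pc_lt hd (q := clamp r) ?_ hS0
    rw [Russo.coe_clamp_of_mem (by linarith [pc_nonneg (d := d), hr.1]) hr.2.le]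
    exact hr.1

/-! ### Counting at the boundary of the box -/

/-- A point of `Λ_n` with a neighbour outside `Λ_n` lies on `∂Λ_n`. -/
theorem mem_boundary_of_adj_notMem_box {n : ℕ} {x y : Vertex d} (hx : x ∈ box d n)
    (hadj : (lattice d).Adj x y) (hy : y ∉ box d n) : x ∈ boundary d n := by
  refine ⟨hx, ?_⟩
  by_contra hcon
  apply hy
  intro i
  have h1 := lattice_adj_abs_sub_le hadj i
  have h2 : |x i| ≤ n := hx i
  have h3 : |x i| ≠ n := fun h => hcon ⟨i, h⟩
  have h4 : |x i| < n := lt_of_le_of_ne h2 h3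
  have h5 : |y i| ≤ |x i| + |x i - y i| := by
    calc |y i| = |x i - (x i - y i)| := by rw [sub_sub_cancel]
      _ ≤ |x i| + |x i - y i| := abs_sub _ _
  linarith

/-- The outward step from `x` in direction `i`: `+e_i` if `x_i ≥ 0`, `−e_i` otherwise. -/
noncomputable def outStep (x : Vertex d) (i : Fin d) : Vertex d := L2.step x i (decide (0 ≤ x i))

/-- For `n ≥ 1`, every neighbour of `x ∈ Λ_n` outside `Λ_n` is an outward step: at most `d` of them. -/
theorem card_outNbrs_box_le {n : ℕ} (hn : 1 ≤ n) {x : Vertex d} (hx : x ∈ box d n) :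
    (outNbrs (box d n) x).card ≤ d := by
  have hsub : outNbrs (box d n) x ⊆ (Finset.univ : Finset (Fin d)).image (outStep x) := by
    intro y hy
    obtain ⟨hadj, hyB⟩ := mem_outNbrs.1 hy
    obtain ⟨i, b, rfl⟩ := L2.exists_step_of_adj hadj
    refine Finset.mem_image.2 ⟨i, Finset.mem_univ i, ?_⟩
    have hxi : -(n : ℤ) ≤ x i ∧ x i ≤ n := abs_le.1 (hx i)
    have hn' : (1 : ℤ) ≤ n := by exact_mod_cast hn
    have hstep_j : ∀ j, j ≠ i → L2.step x i b j = x j := fun j hj => by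
      simp [L2.step, Function.update_of_ne hj]
    -- the coordinate `i` of the step leaves the box
    have hout : (n : ℤ) < |L2.step x i b i| := by
      by_contra hcon
      apply hyB
      intro j
      by_cases hj : j = i
      · subst hj; exact not_lt.1 hcon
      · rw [hstep_j j hj]; exact hx j
    unfold outStep
    cases b with
    | true =>
      have hsi : L2.step x i true i = x i + 1 := by simp [L2.step]
      rw [hsi] at hout
      have h0 : 0 ≤ x i := by
        rcases lt_abs.1 hout with h | h <;> omega
      rw [decide_eq_true h0]
    | false =>
      have hsi : L2.step x i false i = x i - 1 := by simp [L2.step]; ring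
      rw [hsi] at hout
      have h0 : ¬ 0 ≤ x i := by
        rcases lt_abs.1 hout with h | h <;> omega
      rw [decide_eq_false h0]
  calc (outNbrs (box d n) x).card ≤ ((Finset.univ : Finset (Fin d)).image (outStep x)).card :=
        Finset.card_le_card hsub
    _ ≤ (Finset.univ : Finset (Fin d)).card := Finset.card_image_le
    _ = d := Finset.card_fin d

/-- `∂Λ_n` as a finset. -/
noncomputable def bdryF (d n : ℕ) : Finset (Vertex d) := (boxF d n).filter fun x => x ∈ boundary d n

/-- Membership in `bdryF`. -/
theorem mem_bdryF {n : ℕ} {x : Vertex d} : x ∈ bdryF d n ↔ x ∈ boundary d n := by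
  rw [bdryF, Finset.mem_filter, mem_boxF]
  exact ⟨fun h => h.2, fun h => ⟨h.1, h⟩⟩

/-- The slice `{x ∈ Λ_n : x_i = s}` has at most `(2n+1)^{d−1}` points. -/
theorem card_slice_le (n : ℕ) (i : Fin d) (s : ℤ) :
    ((boxF d n).filter fun x => x i = s).card ≤ (2 * n + 1) ^ (d - 1) := by
  have hsub : ((boxF d n).filter fun x => x i = s) ⊆
      Fintype.piFinset fun j : Fin d => if j = i then ({s} : Finset ℤ) else Finset.Icc (-(n : ℤ)) n := by
    intro x hx
    rw [Finset.mem_filter, mem_boxF] at hx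
    rw [Fintype.mem_piFinset]
    intro j
    by_cases hj : j = i
    · subst hj; simp [hx.2]
    · simp only [hj, if_false, Finset.mem_Icc]
      exact abs_le.1 (hx.1 j)
  refine (Finset.card_le_card hsub).trans ?_
  rw [Fintype.card_piFinset]
  have hprod : ∀ j : Fin d, (if j = i then ({s} : Finset ℤ) else Finset.Icc (-(n : ℤ)) n).card =
      if j = i then 1 else 2 * n + 1 := by
    intro j
    by_cases hj : j = i
    · simp [hj]
    · simp only [hj, if_false, Int.card_Icc]
      omega
  simp only [hprod]
  rw [Finset.prod_ite, Finset.prod_const_one, one_mul, Finset.prod_const]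
  have hcard : ((Finset.univ : Finset (Fin d)).filter fun j => ¬ j = i).card = d - 1 := by
    have : ((Finset.univ : Finset (Fin d)).filter fun j => ¬ j = i) = Finset.univ.erase i := by
      ext j
      simp [Finset.mem_erase]
    rw [this, Finset.card_erase_of_mem (Finset.mem_univ i), Finset.card_univ, Fintype.card_fin]
  rw [hcard]

/-- `|∂Λ_n| ≤ 2d (2n+1)^{d−1}`. -/
theorem card_bdryF_le (n : ℕ) : (bdryF d n).card ≤ 2 * d * (2 * n + 1) ^ (d - 1) := by
  have hsub : bdryF d n ⊆ (Finset.univ : Finset (Fin d)).biUnion fun i =>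
      ((boxF d n).filter fun x => x i = (n : ℤ)) ∪ ((boxF d n).filter fun x => x i = -(n : ℤ)) := by
    intro x hx
    obtain ⟨hxB, i, hi⟩ := mem_bdryF.1 hx
    refine Finset.mem_biUnion.2 ⟨i, Finset.mem_univ i, ?_⟩
    rcases abs_eq (by omega : (0 : ℤ) ≤ n) |>.1 hi with h | h
    · exact Finset.mem_union_left _ (Finset.mem_filter.2 ⟨mem_boxF.2 hxB, h⟩)
    · exact Finset.mem_union_right _ (Finset.mem_filter.2 ⟨mem_boxF.2 hxB, h⟩)
  calc (bdryF d n).card ≤ ((Finset.univ : Finset (Fin d)).biUnion fun i =>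
        ((boxF d n).filter fun x => x i = (n : ℤ)) ∪ ((boxF d n).filter fun x => x i = -(n : ℤ))).card :=
        Finset.card_le_card hsub
    _ ≤ ∑ i : Fin d, (((boxF d n).filter fun x => x i = (n : ℤ)) ∪
          ((boxF d n).filter fun x => x i = -(n : ℤ))).card := Finset.card_biUnion_le
    _ ≤ ∑ i : Fin d, (2 * (2 * n + 1) ^ (d - 1)) := by
        refine Finset.sum_le_sum fun i _ => ?_
        calc (((boxF d n).filter fun x => x i = (n : ℤ)) ∪ ((boxF d n).filter fun x => x i = -(n : ℤ))).card
            ≤ ((boxF d n).filter fun x => x i = (n : ℤ)).card +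
                ((boxF d n).filter fun x => x i = -(n : ℤ)).card := Finset.card_union_le _ _
          _ ≤ (2 * n + 1) ^ (d - 1) + (2 * n + 1) ^ (d - 1) :=
              Nat.add_le_add (card_slice_le n i (n : ℤ)) (card_slice_le n i (-(n : ℤ)))
          _ = 2 * (2 * n + 1) ^ (d - 1) := by ring
    _ = 2 * d * (2 * n + 1) ^ (d - 1) := by
        rw [Finset.sum_const, Finset.card_univ, Fintype.card_fin, smul_eq_mul]
        ring

/-! ### CRIT-LOWER -/

/-- `{0 ↔_{Λ_n} x} ⊆ {0 ↔ ∂Λ_n}` for `x ∈ ∂Λ_n`. -/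
theorem P_connIn_box_le (p : I) {n : ℕ} {x : Vertex d} (hx : x ∈ boundary d n) :
    (P d p {ω : Config d | ConnIn (box d n) ω 0 x}).toReal ≤ (P d p (toBoundary d n)).toReal :=
  ENNReal.toReal_mono (measure_ne_top _ _) (measure_mono fun _ hω => ⟨x, hx, conn_of_connIn hω⟩)

/-- `Λ_n` as a finset, as a set. -/
theorem coe_boxF (n : ℕ) : (↑(boxF d n) : Set (Vertex d)) = box d n := Set.Finite.coe_toFinset _

/-- `0 ∈ ∂Λ_0` (`d ≥ 1`). -/
theorem zero_mem_boundary_zero (hd : 1 ≤ d) : (0 : Vertex d) ∈ boundary d 0 :=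
  ⟨fun i => by simp, ⟨⟨0, hd⟩, by simp⟩⟩

/-- **CRIT-LOWER** (CRITLOWER-p4-v1 Theorem): for every `d ≥ 1` and `n`,
`P_{p_c(d)}(0 ↔ ∂Λ_n) ≥ 1 / (2 d² (2n+1)^{d−1})`. -/
theorem crit_lower (hd : 1 ≤ d) (n : ℕ) :
    1 / (2 * (d : ℝ) ^ 2 * (2 * (n : ℝ) + 1) ^ (d - 1)) ≤ (P d (clamp (pc d)) (toBoundary d n)).toReal := by
  have hd' : (1 : ℝ) ≤ d := by exact_mod_cast hd
  have hden : 0 < 2 * (d : ℝ) ^ 2 * (2 * (n : ℝ) + 1) ^ (d - 1) := by positivity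
  rcases Nat.eq_zero_or_pos n with rfl | hn
  · -- `n = 0`: `θ_0 = 1`
    have huniv : toBoundary d 0 = (Set.univ : Set (Config d)) := by
      ext ω
      simp only [Set.mem_univ, iff_true]
      exact ⟨0, zero_mem_boundary_zero hd, SimpleGraph.Reachable.refl _⟩
    rw [huniv, measure_univ, ENNReal.toReal_one, div_le_one hden]
    have : (1 : ℝ) ≤ (d : ℝ) ^ 2 := by nlinarith
    simp only [Nat.cast_zero, mul_zero, zero_add, one_pow]
    linarith
  · -- `n ≥ 1`: Lemma SAT on `S = Λ_n` and the boundary count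
    set p : I := clamp (pc d) with hp
    have hp1 : (p : ℝ) ≤ 1 := p.2.2
    have hp0 : 0 ≤ (p : ℝ) := p.2.1
    set θ : ℝ := (P d p (toBoundary d n)).toReal with hθ
    have hθ0 : 0 ≤ θ := ENNReal.toReal_nonneg
    have hsat : 1 ≤ phi (boxF d n) p := one_le_phi_pc hd (mem_boxF.2 (zero_mem_box n))
    -- each term of `φ` is at most `d · θ`, and only boundary points contribute
    have hterm : ∀ x ∈ boxF d n, ((outNbrs (↑(boxF d n)) x).card : ℝ) *
        (P d p {ω : Config d | ConnIn (↑(boxF d n)) ω 0 x}).toReal ≤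
          if x ∈ boundary d n then (d : ℝ) * θ else 0 := by
      intro x hx
      rw [coe_boxF]
      have hxB : x ∈ box d n := mem_boxF.1 hx
      by_cases hxb : x ∈ boundary d n
      · rw [if_pos hxb]
        have hc : ((outNbrs (box d n) x).card : ℝ) ≤ d := by exact_mod_cast card_outNbrs_box_le hn hxB
        exact mul_le_mul hc (P_connIn_box_le p hxb) ENNReal.toReal_nonneg (by positivity)
      · rw [if_neg hxb]
        have hempty : outNbrs (box d n) x = ∅ := by
          rw [Finset.eq_empty_iff_forall_notMem]
          intro y hy
          obtain ⟨hadj, hyB⟩ := mem_outNbrs.1 hy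
          exact hxb (mem_boundary_of_adj_notMem_box hxB hadj hyB)
        rw [hempty, Finset.card_empty, Nat.cast_zero, zero_mul]
    have hsum : ∑ x ∈ boxF d n, ((outNbrs (↑(boxF d n)) x).card : ℝ) *
        (P d p {ω : Config d | ConnIn (↑(boxF d n)) ω 0 x}).toReal ≤ (bdryF d n).card * ((d : ℝ) * θ) := by
      calc ∑ x ∈ boxF d n, ((outNbrs (↑(boxF d n)) x).card : ℝ) *
            (P d p {ω : Config d | ConnIn (↑(boxF d n)) ω 0 x}).toReal
          ≤ ∑ x ∈ boxF d n, (if x ∈ boundary d n then (d : ℝ) * θ else 0) := Finset.sum_le_sum hterm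
        _ = ∑ x ∈ bdryF d n, (d : ℝ) * θ := by
            rw [bdryF, Finset.sum_filter]
        _ = (bdryF d n).card * ((d : ℝ) * θ) := by
            rw [Finset.sum_const, nsmul_eq_mul]
    have hcard : ((bdryF d n).card : ℝ) ≤ 2 * d * (2 * (n : ℝ) + 1) ^ (d - 1) := by
      have := card_bdryF_le (d := d) n
      exact_mod_cast this
    have hphi : phi (boxF d n) p ≤ 2 * (d : ℝ) ^ 2 * (2 * (n : ℝ) + 1) ^ (d - 1) * θ := by
      unfold phi
      calc (p : ℝ) * ∑ x ∈ boxF d n, ((outNbrs (↑(boxF d n)) x).card : ℝ) *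
            (P d p {ω : Config d | ConnIn (↑(boxF d n)) ω 0 x}).toReal
          ≤ 1 * ((bdryF d n).card * ((d : ℝ) * θ)) := by
            refine mul_le_mul hp1 hsum (Finset.sum_nonneg fun x _ =>
              mul_nonneg (Nat.cast_nonneg _) ENNReal.toReal_nonneg) zero_le_one
        _ ≤ 1 * ((2 * d * (2 * (n : ℝ) + 1) ^ (d - 1)) * ((d : ℝ) * θ)) := by
            gcongr
        _ = 2 * (d : ℝ) ^ 2 * (2 * (n : ℝ) + 1) ^ (d - 1) * θ := by ring
    rw [div_le_iff₀ hden]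
    linarith

end Summit.Ventures.PercRepro0.Sharp
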